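import Literature.AlgebraicGeometry.Resolution.HasseSchmidtTransverseOrder
import Literature.AlgebraicGeometry.Resolution.HasseSchmidtDiffEqDiffOp
import Literature.AlgebraicGeometry.Resolution.HasseSchmidtCoefficients
import Literature.AlgebraicGeometry.Resolution.RegularLocalRingsNormal
import Mathlib.RingTheory.PowerSeries.Basic
import Mathlib.Algebra.Polynomial.Coeff
import Mathlib.FieldTheory.Perfect
import HarnessLib

/-!
# Dual Hasse–Schmidt derivations detect `q`-th powers of regular parameters (`q = p^e`): the symbol
# calculus of the `D_{i,a}` on forms in a regular system of parameters

Topic: `Literature/AlgebraicGeometry/Resolution`. Companion of `HasseSchmidtTransverseOrder.lean` (the structure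
`HasseSchmidtDerivation`, `taylorHom`), `HasseSchmidtDualExistence.lean` (dual Hasse–Schmidt derivations EXIST at the
points of a scheme smooth over a perfect field), `HasseSchmidtCoefficients.lean` / `HasseSchmidtDiffEqDiffOp.lean` (the
formal Hasse derivatives `hasseDeriv R (single i a) = ∂_i^{(a)}` of a polynomial ring: `coeff_hasseDeriv_single`,
`isHomogeneous_hasseDeriv_single`, `hasseDeriv_monomial`) and `RegularSystemOfParameters.lean` /
`RegularLocalRingsNormal.lean` (Matsumura Thm. 17.10: a form of degree `n` in a regular system of parameters with value
in `𝔪^{n+1}` has its coefficients in `𝔪`; initial forms). PROVED here, for a commutative algebra `A` over any base `k`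
and a Hasse–Schmidt derivation `D` of `A/k` DUAL to a family `x : ι → A` in direction `i` (`D_1 x_i = 1`, `D_1 x_l = 0`
for `l ≠ i`, `D_b x_l = 0` for `b ≥ 2`):

* `HasseSchmidtDerivation.op_apply_pow_self` — `D_b(x_i^n) = (n choose b) x_i^{n-b}` (EGA IV₄ (16.11.2.1));
  `op_apply_mul_monomial` — `D_a(c·x^β) = (Σ_{b+b'=a} D_b(c)·(β_i choose b') x_i^{β_i-b'})·Π_{l≠i} x_l^{β_l}` for an
  ARBITRARY coefficient `c ∈ A` (the Taylor morphism is multiplicative and fixes the `x_l`, `l ≠ i`);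
* `HasseSchmidtDerivation.op_eval_sub_eval_hasseDeriv_mem_pow` — **symbol estimate**: on a form `F(x)` of degree `s` in
  elements `x_l` of an ideal `𝔪`, `D_a F(x) ≡ (∂_i^{(a)} F)(x) (mod 𝔪^{s+1-a})` — the coefficients of `F` contribute
  `D_b(c)`, `b ≥ 1`, only against `x_i^{β_i-b'}` with `b' < a`;
* `coeff_mem_maximalIdeal_of_op_eval_mem_pow` — in a REGULAR local ring with regular system of parameters `x` and dual
  derivations `D_i`: if `D_{i,β_i} F(x) ∈ 𝔪^{s-β_i+1}` (`β_i < s`) then the coefficient of `x^β` in the form `F` of degree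
  `s` lies in `𝔪` (symbol estimate + Thm. 17.10 applied to the form `∂_i^{(β_i)} F` of degree `s - β_i`);
* `exists_eq_pow_add_of_dual_hasseSchmidt` — **MAIN THEOREM**: `A` regular local of exponential characteristic `p` with
  PERFECT residue field, `q = p^e`; if `g ∈ 𝔪^q ∖ 𝔪^{q+1}` and `D_{i,a} g ∈ 𝔪^{q-a+1}` for all `i` and `0 < a < q`, then
  `g = y^q + ε` with `y ∈ 𝔪 ∖ 𝔪²` and `ε ∈ 𝔪^{q+1}`: the non-pure coefficients of the initial form vanish in the residue
  field `κ`, so `in(g) = Σ_l c_l X_l^q = (Σ_l c_l^{1/q} X_l)^q` (`κ` perfect), and `y = Σ_l r_l x_l` for lifts `r_l`.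

This is the algebra behind «an element of `℘ ∩ L(Ě,q)_ξ` of order exactly `q` annihilated modulo `𝔪^{q-k+1}` by all
differential operators of order `k < q` is `y^q + ε` with `ord y = 1`» at a closed point of a variety smooth over a perfect
field (used by `Literature/AlgebraicGeometry/Hironaka2017/Proofs/S06BaseHike/Eq55Conv.lean`; the converse direction —
operators of order `< p^e` are linear over `p^e`-th powers — is `DiffOpFrobeniusLinear.lean`).

## What is NOT here

* The converse (an element `y^q + ε` satisfies the differential conditions): `DiffOpFrobeniusLinear.lean` and
  `Hironaka2017/Proofs/S06BaseHike/Eq55Heads.lean` (`mem_llPrehead_R2_of_isLLHeadAt`).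
* Non-perfect residue fields: there the conclusion fails (`x_1^q + t x_2^q`, `t` a unit whose residue is not a `p`-th
  power); only the statement `in(g) ∈ κ·{X_l^q}` (`coeff_mem_maximalIdeal_of_op_eval_mem_pow`) survives.

## Sources

* [EGAIV4] A. Grothendieck, J. Dieudonné, ÉGA IV₄, Publ. Math. IHÉS 32 (1967), Thm. 16.11.2 and (16.11.2.1)–(16.11.2.2)
  (`D_ν(z^μ) = (μ choose ν) z^{μ-ν}`; Leibniz rule of the `D_ν`).
* [Matsumura1987] H. Matsumura, *Commutative Ring Theory* (1986), Thm. 17.10 (`gr_𝔪(A) ≅ k[X_1, …, X_d]` for a regular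
  local ring), §27 (higher derivations).
-/

noncomputable section

namespace Literature.AlgebraicGeometry.Resolution

open IsLocalRing _root_.MvPolynomial _root_.Finset

universe u v

namespace HasseSchmidtDerivation

/-! ## Components of a dual Hasse–Schmidt derivation on monomials in the parameters -/

section Monomials

variable {k : Type u} {A : Type v} [CommSemiring k] [CommRing A] [Algebra k A]
variable {ι : Type*} [Fintype ι] [DecidableEq ι] (D : HasseSchmidtDerivation k A) (x : ι → A) (i : ι)
variable (hD : ∀ b l, D.op b (x l) = if b = 0 then x l else if b = 1 ∧ l = i then 1 else 0)
include hD

omit [Fintype ι] in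
/-- The Taylor homomorphism of a Hasse–Schmidt derivation dual to `x` in direction `i` sends
`x_i ↦ x_i + T`. [cite: Matsumura1987, §27] -/
theorem taylorHom_apply_self : D.taylorHom (x i) = PowerSeries.C (x i) + PowerSeries.X := by
  ext b
  rw [coeff_taylorHom, hD, map_add, PowerSeries.coeff_C, PowerSeries.coeff_X]
  rcases Nat.eq_zero_or_pos b with rfl | hb
  · simp
  · rw [if_neg hb.ne', if_neg hb.ne', zero_add]
    by_cases h1 : b = 1
    · rw [if_pos ⟨h1, rfl⟩, if_pos h1]
    · rw [if_neg (fun h => h1 h.1), if_neg h1]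

omit [Fintype ι] in
/-- … and `x_l ↦ x_l` for `l ≠ i`. [cite: Matsumura1987, §27] -/
theorem taylorHom_apply_of_ne {l : ι} (hl : l ≠ i) : D.taylorHom (x l) = PowerSeries.C (x l) := by
  ext b
  rw [coeff_taylorHom, hD, PowerSeries.coeff_C]
  rcases Nat.eq_zero_or_pos b with rfl | hb
  · simp
  · rw [if_neg hb.ne', if_neg hb.ne', if_neg (fun h => hl h.2)]

omit [Fintype ι] in
/-- **`D_b(x_i^n) = (n choose b) x_i^{n-b}`** for a Hasse–Schmidt derivation dual to `x` in direction
`i` (the coefficient of `T^b` in `(x_i + T)^n`). [cite: EGAIV4, Thm. 16.11.2 (16.11.2.1)] -/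
theorem op_apply_pow_self (b n : ℕ) : D.op b (x i ^ n) = (n.choose b : A) * x i ^ (n - b) := by
  rw [← coeff_taylorHom, map_pow, D.taylorHom_apply_self x i hD]
  have h : (PowerSeries.C (x i) + PowerSeries.X : PowerSeries A) =
      ((Polynomial.X + Polynomial.C (x i) : Polynomial A) : PowerSeries A) := by
    rw [Polynomial.coe_add, Polynomial.coe_X, Polynomial.coe_C, add_comm]
  rw [h, ← Polynomial.coe_pow, Polynomial.coeff_coe, Polynomial.coeff_X_add_C_pow, mul_comm]

/-- The Taylor homomorphism fixes every monomial in the `x_l`, `l ≠ i`. [folklore] -/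
private theorem taylorHom_prod_erase (β : ι → ℕ) :
    D.taylorHom (∏ l ∈ univ.erase i, x l ^ β l) = PowerSeries.C (∏ l ∈ univ.erase i, x l ^ β l) := by
  rw [map_prod, map_prod]
  refine Finset.prod_congr rfl fun l hl => ?_
  rw [map_pow, map_pow, D.taylorHom_apply_of_ne x i hD (Finset.ne_of_mem_erase hl)]

/-- **Components of a dual Hasse–Schmidt derivation on a monomial with a coefficient**:
`D_a(c · x^β) = (Σ_{b+b'=a} D_b(c) · (β_i choose b') x_i^{β_i - b'}) · Π_{l≠i} x_l^{β_l}`.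
[cite: EGAIV4, Thm. 16.11.2 (16.11.2.2)] -/
theorem op_apply_mul_monomial (a : ℕ) (c : A) (β : ι → ℕ) :
    D.op a (c * ∏ l, x l ^ β l) =
      (∑ q ∈ antidiagonal a, D.op q.1 c * ((β i).choose q.2 * x i ^ (β i - q.2))) *
        ∏ l ∈ univ.erase i, x l ^ β l := by
  rw [← Finset.mul_prod_erase univ (fun l => x l ^ β l) (mem_univ i), ← mul_assoc,
    ← coeff_taylorHom, map_mul, D.taylorHom_prod_erase x i hD, PowerSeries.coeff_mul_C, map_mul,
    PowerSeries.coeff_mul]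
  congr 1
  refine Finset.sum_congr rfl fun q _ => ?_
  rw [coeff_taylorHom, coeff_taylorHom, D.op_apply_pow_self x i hD]

end Monomials

/-! ## The symbol estimate: `D_a` acts on forms of degree `s` as `∂_i^{(a)}` modulo `𝔪^{s-a+1}` -/

section Estimate

variable {k : Type u} {A : Type v} [CommSemiring k] [CommRing A] [Algebra k A]
variable {ι : Type*} [Fintype ι] [DecidableEq ι] (D : HasseSchmidtDerivation k A) (x : ι → A) (i : ι)
variable (hD : ∀ b l, D.op b (x l) = if b = 0 then x l else if b = 1 ∧ l = i then 1 else 0)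
variable (M : Ideal A) (hxM : ∀ l, x l ∈ M)
include hD hxM

/-- **Symbol estimate for a dual Hasse–Schmidt derivation**: on a form `F(x)` of degree `s` in
elements `x_l` of an ideal `𝔪` (coefficients ARBITRARY elements of `A`), `D_a` agrees with the formal
Hasse derivative `∂_i^{(a)}` (tree `hasseDeriv`, acting on the coefficients trivially) modulo
`𝔪^{s+1-a}`: the coefficients contribute `D_b(c)`, `b ≥ 1`, only against `x_i^{β_i-b'}` with `b' < a`.
[cite: EGAIV4, Thm. 16.11.2] -/
theorem op_eval_sub_eval_hasseDeriv_mem_pow {s : ℕ} {F : MvPolynomial ι A} (hF : F.IsHomogeneous s)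
    (a : ℕ) :
    D.op a (eval x F) - eval x (hasseDeriv A (Finsupp.single i a) F) ∈ M ^ (s + 1 - a) := by
  classical
  -- reduce to monomials of degree `s`
  rw [F.as_sum, map_sum, map_sum, map_sum, map_sum, ← Finset.sum_sub_distrib]
  refine Ideal.sum_mem _ fun β hβ => ?_
  have hdeg : ∑ l, β l = s := by
    have h := hF (mem_support_iff.mp hβ)
    rw [Finsupp.weight_apply, Finsupp.sum_fintype _ _ (fun _ => by simp)] at h
    simpa using h
  set c := coeff β F
  -- both sides on the monomial `c x^β`
  have hev : eval x (monomial β c) = c * ∏ l, x l ^ β l := by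
    rw [eval_monomial, Finsupp.prod_fintype _ _ (fun _ => pow_zero _)]
  have hevH : eval x (hasseDeriv A (Finsupp.single i a) (monomial β c)) =
      D.op 0 c * ((β i).choose a * x i ^ (β i - a)) * ∏ l ∈ univ.erase i, x l ^ β l := by
    rw [hasseDeriv_monomial, map_mul, map_natCast, eval_monomial,
      Finsupp.prod_fintype _ _ (fun _ => pow_zero _),
      ← Finset.mul_prod_erase univ (fun l => x l ^ (β - Finsupp.single i a) l) (mem_univ i),
      op_zero_apply]
    rcases Nat.eq_zero_or_pos a with rfl | ha
    · simp [mul_assoc]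
    · rw [Finsupp.support_single _ ha.ne', Finset.prod_singleton, Finsupp.single_eq_same]
      have hrest : ∏ l ∈ univ.erase i, x l ^ (β - Finsupp.single i a) l =
          ∏ l ∈ univ.erase i, x l ^ β l := by
        refine Finset.prod_congr rfl fun l hl => ?_
        rw [Finsupp.tsub_apply, Finsupp.single_eq_of_ne (Finset.ne_of_mem_erase hl), tsub_zero]
      rw [hrest, Finsupp.tsub_apply, Finsupp.single_eq_same]
      ring
  rw [hev, hevH, D.op_apply_mul_monomial x i hD]
  -- isolate the main term `(0, a)` of the antidiagonal sum
  have h0a : ((0 : ℕ), a) ∈ antidiagonal a := by simp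
  rw [← Finset.add_sum_erase _ _ h0a, add_mul, add_sub_cancel_left, Finset.sum_mul]
  refine Ideal.sum_mem _ fun q hq => ?_
  obtain ⟨hne, hq'⟩ := Finset.mem_erase.mp hq
  rw [mem_antidiagonal] at hq'
  have hq2 : q.2 + 1 ≤ a := by
    rcases Nat.eq_zero_or_pos q.1 with h1 | h1
    · exact absurd (Prod.ext h1 (by omega)) hne
    · omega
  -- `x_i^{β_i - q.2} · Π_{l≠i} x_l^{β_l} ∈ 𝔪^{(β_i - q.2) + (s - β_i)} ⊆ 𝔪^{s+1-a}`
  have hw : ∏ l ∈ univ.erase i, x l ^ β l ∈ M ^ (s - β i) := by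
    have hsum : ∑ l ∈ univ.erase i, β l = s - β i := by
      rw [← hdeg, ← Finset.add_sum_erase univ β (mem_univ i)]; omega
    rw [← hsum, ← Finset.prod_pow_eq_pow_sum]
    exact Ideal.prod_mem_prod fun l _ => Ideal.pow_mem_pow (hxM l) _
  have hxi : x i ^ (β i - q.2) ∈ M ^ (β i - q.2) := Ideal.pow_mem_pow (hxM i) _
  have hβi : β i ≤ s := by rw [← hdeg]; exact Finset.single_le_sum (fun _ _ => Nat.zero_le _) (mem_univ i)
  have hle : s + 1 - a ≤ (β i - q.2) + (s - β i) := by omega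
  refine Ideal.pow_le_pow_right hle ?_
  have hmem : x i ^ (β i - q.2) * ∏ l ∈ univ.erase i, x l ^ β l ∈ M ^ ((β i - q.2) + (s - β i)) := by
    rw [pow_add]
    exact Ideal.mul_mem_mul hxi hw
  have heq : D.op q.1 c * (((β i).choose q.2 : A) * x i ^ (β i - q.2)) * ∏ l ∈ univ.erase i, x l ^ β l =
      (D.op q.1 c * ((β i).choose q.2 : A)) * (x i ^ (β i - q.2) * ∏ l ∈ univ.erase i, x l ^ β l) := by
    ring
  rw [heq]
  exact Ideal.mul_mem_left _ _ hmem

end Estimate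

end HasseSchmidtDerivation

/-! ## In a regular local ring: non-pure coefficients vanish modulo `𝔪`, and the `q`-th power form -/

section RegularLocal

variable {k : Type u} {R : Type v} [CommSemiring k] [CommRing R] [Algebra k R] [IsRegularLocalRing R]
variable {d : ℕ} (hd : (maximalIdeal R).spanFinrank = d)
  (x : Fin d → R) (hx : Ideal.span (Set.range x) = maximalIdeal R)
  (D : Fin d → HasseSchmidtDerivation k R)
  (hD : ∀ i b l, (D i).op b (x l) = if b = 0 then x l else if b = 1 ∧ l = i then 1 else 0)
include hd hx hD

/-- **Dual Hasse–Schmidt derivations read off the non-pure coefficients of an initial form**: if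
`F(x)` is a form of degree `s` in a regular system of parameters `x` and `D_a F(x) ∈ 𝔪^{s-a+1}` for
the Hasse–Schmidt derivation dual to `x_i`, `a = β_i < s`, then the coefficient of
`x^β` in `F` (`β_i < s`) lies in `𝔪` (symbol estimate + Matsumura Thm. 17.10: a form of degree `s - a` with value
in `𝔪^{s-a+1}` has its coefficients in `𝔪`). [cite: Matsumura1987, Thm. 17.10]
[cite: EGAIV4, Thm. 16.11.2] -/
theorem coeff_mem_maximalIdeal_of_op_eval_mem_pow {s : ℕ} {F : MvPolynomial (Fin d) R}
    (hF : F.IsHomogeneous s) {β : Fin d →₀ ℕ} {i : Fin d} (hlt : β i < s)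
    (hDF : (D i).op (β i) (eval x F) ∈ maximalIdeal R ^ (s - β i + 1)) :
    F.coeff β ∈ maximalIdeal R := by
  classical
  have hxm : ∀ l, x l ∈ maximalIdeal R := fun l => hx ▸ Ideal.subset_span ⟨l, rfl⟩
  set a := β i with ha
  set G := hasseDeriv R (Finsupp.single i a) F with hG
  have hGhom : G.IsHomogeneous (s - a) := isHomogeneous_hasseDeriv_single (R := R) hF i a
  have hest := (D i).op_eval_sub_eval_hasseDeriv_mem_pow x i (hD i) (maximalIdeal R) hxm hF a
  have hGm : eval x G ∈ maximalIdeal R ^ (s - a + 1) := by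
    rw [show s + 1 - a = s - a + 1 by omega] at hest
    have h := sub_mem hDF hest
    rwa [sub_sub_cancel] at h
  have hcoef := coeff_mem_maximalIdeal_of_eval_mem_pow hd x hx hGhom hGm (β - Finsupp.single i a)
  rw [hG, coeff_hasseDeriv_single, Finsupp.tsub_apply, Finsupp.single_eq_same, ← ha, Nat.sub_self,
    zero_add, Nat.choose_self, Nat.cast_one, one_mul,
    tsub_add_cancel_of_le (Finsupp.single_le_iff.mpr (by rw [ha]))] at hcoef
  exact hcoef

omit [Algebra k R] [IsRegularLocalRing R] hd hx hD in
/-- An exponent of total degree `q` which is not `q·e_l` has a coordinate strictly between `0` and `q`.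
[folklore] -/
private theorem exists_coord_pos_lt_of_ne_single {q : ℕ} (hq : 0 < q) {β : Fin d →₀ ℕ} (hβ : ∑ l, β l = q)
    (hne : ∀ l, β ≠ Finsupp.single l q) : ∃ i, 0 < β i ∧ β i < q := by
  classical
  by_contra hcon
  push Not at hcon
  have hβ0 : β ≠ 0 := by
    rintro rfl
    simp only [Finsupp.coe_zero, Pi.zero_apply, Finset.sum_const_zero] at hβ
    omega
  obtain ⟨i, hi⟩ := Finsupp.ne_iff.mp hβ0
  rw [Finsupp.zero_apply] at hi
  have hqi : q ≤ β i := hcon i (Nat.pos_of_ne_zero hi)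
  have hle : β i ≤ q := by
    rw [← hβ]; exact Finset.single_le_sum (fun _ _ => Nat.zero_le _) (Finset.mem_univ i)
  have hβi : β i = q := le_antisymm hle hqi
  refine hne i (Finsupp.ext fun l => ?_)
  by_cases hl : l = i
  · subst hl; rw [Finsupp.single_eq_same, hβi]
  · rw [Finsupp.single_eq_of_ne hl]
    have hrest : ∑ l ∈ Finset.univ.erase i, β l = 0 := by
      have := Finset.add_sum_erase Finset.univ β (Finset.mem_univ i)
      omega
    exact Finset.sum_eq_zero_iff.mp hrest l (Finset.mem_erase.mpr ⟨hl, Finset.mem_univ l⟩)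

/-- **Main theorem — dual Hasse–Schmidt derivations detect `q`-th powers of regular parameters.**
Let `R` be a regular local ring of exponential characteristic `p` whose residue field is PERFECT, `x` a
regular system of parameters with dual Hasse–Schmidt derivations `D_1, …, D_d` (`D_{i,1} x_l = δ_{il}`,
`D_{i,b} x_l = 0` for `b ≥ 2`), `q = p^e`. If `g ∈ 𝔪^q ∖ 𝔪^{q+1}` and `D_{i,a} g ∈ 𝔪^{q-a+1}` for all `i`
and all `0 < a < q`, then `g = y^q + ε` with `ord y = 1` (`y ∈ 𝔪 ∖ 𝔪²`) and `ε ∈ 𝔪^{q+1}`: the initial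
form of `g` has its non-pure coefficients in `𝔪` (`coeff_mem_maximalIdeal_of_op_eval_mem_pow`), so it
is `Σ_l c_l X_l^q = (Σ_l c_l^{1/q} X_l)^q` over the perfect residue field, and `y = Σ_l r_l x_l` for lifts
`r_l` of the `q`-th roots. [cite: EGAIV4, Thm. 16.11.2] [cite: Matsumura1987, Thm. 17.10] -/
theorem exists_eq_pow_add_of_dual_hasseSchmidt (p : ℕ) [ExpChar R p] [ExpChar (ResidueField R) p]
    [PerfectField (ResidueField R)] (e : ℕ) {g : R} (hg : g ∈ maximalIdeal R ^ p ^ e)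
    (hg' : g ∉ maximalIdeal R ^ (p ^ e + 1))
    (hDg : ∀ i a, 0 < a → a < p ^ e → (D i).op a g ∈ maximalIdeal R ^ (p ^ e - a + 1)) :
    ∃ y ε : R, g = y ^ p ^ e + ε ∧ y ∈ maximalIdeal R ∧ y ∉ maximalIdeal R ^ 2 ∧
      ε ∈ maximalIdeal R ^ (p ^ e + 1) := by
  classical
  have hxm : ∀ l, x l ∈ maximalIdeal R := fun l => hx ▸ Ideal.subset_span ⟨l, rfl⟩
  set q := p ^ e with hq
  have hq0 : 0 < q := pow_pos (expChar_pos R p) e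
  obtain ⟨F, hF, hFg⟩ := exists_isHomogeneous_eval_eq_of_mem_pow x hx hg
  -- non-pure coefficients lie in `𝔪`
  have hnp : ∀ β : Fin d →₀ ℕ, (∀ l, β ≠ Finsupp.single l q) → F.coeff β ∈ maximalIdeal R := by
    intro β hne
    by_cases hβ : β ∈ F.support
    · have hdeg : ∑ l, β l = q := by
        have h := hF (mem_support_iff.mp hβ)
        rw [Finsupp.weight_apply, Finsupp.sum_fintype _ _ (fun _ => by simp)] at h
        simpa using h
      obtain ⟨i, h0, hlt⟩ := exists_coord_pos_lt_of_ne_single hq0 hdeg hne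
      exact coeff_mem_maximalIdeal_of_op_eval_mem_pow hd x hx D hD hF hlt (hFg ▸ hDg i _ h0 hlt)
    · rw [notMem_support_iff.mp hβ]; exact zero_mem _
  -- `q`-th roots of the pure coefficients in the perfect residue field, lifted to `R`
  haveI := PerfectField.toPerfectRing p (K := ResidueField R)
  have hroot : ∀ l, ∃ r : R, residue R (F.coeff (Finsupp.single l q)) = residue R r ^ q := by
    intro l
    obtain ⟨r, hr⟩ := Ideal.Quotient.mk_surjective
      ((iterateFrobeniusEquiv (ResidueField R) p e).symm (residue R (F.coeff (Finsupp.single l q))))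
    refine ⟨r, ?_⟩
    change Ideal.Quotient.mk _ r = _ at hr
    rw [← iterateFrobenius_def, ← coe_iterateFrobeniusEquiv,
      show residue R r = Ideal.Quotient.mk _ r from rfl, hr, RingEquiv.apply_symm_apply]
  choose r hr using hroot
  -- `y = Σ r_l x_l`, `ε = g - y^q = F'(x)` with `F'` a form of degree `q` with coefficients in `𝔪`
  set y := ∑ l, r l * x l with hy
  set F' := F - ∑ l, monomial (Finsupp.single l q) (r l ^ q) with hF'
  have hF'hom : F'.IsHomogeneous q := by
    refine hF.sub (MvPolynomial.IsHomogeneous.sum _ _ _ fun l _ => ?_)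
    exact isHomogeneous_monomial _ (by
      rw [Finsupp.degree_single])
  have hyq : y ^ q = ∑ l, r l ^ q * x l ^ q := by
    rw [hy, hq, ← iterateFrobenius_def, map_sum]
    refine Finset.sum_congr rfl fun l _ => ?_
    rw [map_mul, iterateFrobenius_def, iterateFrobenius_def]
  have hevF' : eval x F' = g - y ^ q := by
    rw [hF', map_sub, hFg, map_sum, hyq]
    congr 1
    refine Finset.sum_congr rfl fun l _ => ?_
    rw [eval_monomial, Finsupp.prod_single_index (h := fun n e => x n ^ e) (pow_zero _)]
  have hcoefF' : ∀ β, F'.coeff β ∈ maximalIdeal R := by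
    intro β
    rw [hF', coeff_sub, coeff_sum]
    simp only [coeff_monomial]
    by_cases hβ : ∃ l, β = Finsupp.single l q
    · obtain ⟨l, rfl⟩ := hβ
      rw [Finset.sum_eq_single l (fun l' _ hl' => if_neg fun h =>
          hl' (Finsupp.single_left_injective hq0.ne' h)) (fun h => absurd (Finset.mem_univ l) h),
        if_pos rfl, ← residue_eq_zero_iff, map_sub, hr l, map_pow, sub_self]
    · push Not at hβ
      rw [Finset.sum_eq_zero fun l _ => if_neg (fun h => hβ l h.symm), sub_zero]
      exact hnp β hβ
  have hmapF' : map (residue R) F' = 0 := by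
    ext β; rw [coeff_map, coeff_zero, residue_eq_zero_iff]; exact hcoefF' β
  have hε : g - y ^ q ∈ maximalIdeal R ^ (q + 1) := by
    rw [← hevF']
    exact eval_mem_pow_succ_of_map_residue_eq_zero x hx hF'hom hmapF'
  refine ⟨y, g - y ^ q, by ring, Ideal.sum_mem _ fun l _ => Ideal.mul_mem_left _ _ (hxm l), ?_, hε⟩
  -- `y ∉ 𝔪²`: otherwise all `r_l ∈ 𝔪`, all coefficients of `F` in `𝔪`, and `g ∈ 𝔪^{q+1}`
  intro hy2
  set L : MvPolynomial (Fin d) R := ∑ l, monomial (Finsupp.single l 1) (r l) with hL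
  have hLhom : L.IsHomogeneous 1 :=
    MvPolynomial.IsHomogeneous.sum _ _ _ fun l _ => isHomogeneous_monomial _ (by
      rw [Finsupp.degree_single])
  have hevL : eval x L = y := by
    rw [hL, map_sum, hy]
    refine Finset.sum_congr rfl fun l _ => ?_
    rw [eval_monomial, Finsupp.prod_single_index (h := fun n e => x n ^ e) (pow_zero _), pow_one]
  have hrm : ∀ l, r l ∈ maximalIdeal R := by
    intro l
    have h := coeff_mem_maximalIdeal_of_eval_mem_pow hd x hx hLhom (by rw [hevL]; exact hy2)
      (Finsupp.single l 1)
    rw [hL, coeff_sum] at h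
    simp only [coeff_monomial] at h
    rwa [Finset.sum_eq_single l (fun l' _ hl' => if_neg fun h' =>
        hl' (Finsupp.single_left_injective one_ne_zero h')) (fun h' => absurd (Finset.mem_univ l) h'),
      if_pos rfl] at h
  have hall : ∀ β, F.coeff β ∈ maximalIdeal R := by
    intro β
    by_cases hβ : ∃ l, β = Finsupp.single l q
    · obtain ⟨l, rfl⟩ := hβ
      rw [← residue_eq_zero_iff, hr l, (residue_eq_zero_iff _).mpr (hrm l), zero_pow hq0.ne']
    · push Not at hβ
      exact hnp β hβ
  have hmapF : map (residue R) F = 0 := by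
    ext β; rw [coeff_map, coeff_zero, residue_eq_zero_iff]; exact hall β
  exact hg' (hFg ▸ eval_mem_pow_succ_of_map_residue_eq_zero x hx hF hmapF)

end RegularLocal

end Literature.AlgebraicGeometry.Resolution

end
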